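import Summits.HodgeConjecture.CorCM.Census.TwistGenerationClosing

/-!
# Uniform twist generation, VII: THE CLOSING FACES — the transfer faces reduce to the transfers, the equatorial square to the upper star

COR-CM (cell `pub-hodgecm2`), count-neutral kernel combinatorics by the binder seat b09 (gen 36; lane UNIFORM TWIST GENERATION, part VII), on
parts I–VI used BY NAME.  Theorems only: no definition, no `decide`, no certificate, no named fact, no `sorry`.
HONEST FRAMING: `HC_CM` is NOT proved, here or anywhere in the tree; nothing here is a period or a headline.

Along a datum `θ : G ≃ ℤ/2n × B` (`n ≥ 2`, `3 ≤ |B|`), at the profile type `prof Q` with `2|Q| + 1 ≤ |B| ≤ 2|Q| + 2` and two columns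
`b₁ ≠ b₂` outside `Q`, for a submodule `L` holding the STAR FORMS of the near classes (part IV (b)):
* §1 **the transfer face** `gface (prof Q) θ⁻¹(k, b₁) θ⁻¹(0, b₂)` (`1 ≤ k < n`) lies in `L` only together with the transfer `trans 0 k b₁`
  (`trans_zero_mem`): its four corners are `prof Q`, `(prof Q)^{(k,b₁)}` (near class of `0`) and `prof Q₂`, `(prof Q₂)^{(k,b₁)}` (near class of `1`,
  `Q₂ = insert b₂ Q`), and the two star differences are the atom-minus-centre vectors of the place `(k, b₁)` at the centres `0` and `1`;
* §2 **the equatorial square** `gface (prof Q) θ⁻¹(0, b₁) θ⁻¹(0, b₂)` lies in `L ⊇ ℤ⟨pairs⟩ + ℤ⟨interior transfers⟩` only together with the upper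
  star `wplus 0` (`wplus_zero_mem`): its corners are `prof Q` and `prof Q₁, prof Q₂, prof Q₁₂` (near class of `1`), whose star forms are explicit
  (`thetaG_prof_zero`, `thetaG_prof_one`), and the lower atoms of the centre `1` are the canonical atoms of the centre `0` modulo a chain of interior
  transfers and two pairs (`lower_add_catom_sub_mem`);
* §3 base changes of transfers and upper stars (`mapDomain_rt_trans`, `mapDomain_rt_wplus`): one of each yields all.

## References
* [Pohlmann1968] H. Pohlmann, Algebraic cycles on abelian varieties of complex multiplication type, Ann. of Math. 88 (1968), Thm 1.
* [Milne1999] J. S. Milne, Lefschetz motives and the Tate conjecture, Compositio Math. 117 (1999), Prop. 2.1, p. 54.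
-/

namespace Summit.HodgeConjecture.CorCM.Census.TwistGeneration

open Finset
open Summit.HodgeConjecture.CorCM.Prior.AllgGroup.RfwfAllgGroup
open Summit.HodgeConjecture.CorCM.Census.BlockParity
open Summit.HodgeConjecture.CorCM.Census.Coinvariant

noncomputable section

variable {G : Type*} [Group G] [Fintype G] [DecidableEq G] {c : G}
variable {B : Type} [AddGroup B] [DecidableEq B] [Fintype B]
variable {n : ℕ} [NeZero n] (θ : G ≃ ZMod (2 * n) × B)
variable (hθ : ∀ P Q : G, θ (P * Q) = θ P + θ Q) (hθc : θ c = (((n : ℕ) : ZMod (2 * n)), 0))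

/-! ## §1 The transfer faces -/

/-- **THE TRANSFER FACE REDUCES TO THE TRANSFER.**  If `L` holds the star forms of the near classes and the face
`gface (prof Q) θ⁻¹(k, b₁) θ⁻¹(0, b₂)` (`1 ≤ k < n`, `b₁ ≠ b₂` outside `Q`, `2|Q| + 1 ≤ |B| ≤ 2|Q| + 2`, `3 ≤ |B|`), then `trans 0 k b₁ ∈ L`. [folklore] -/
theorem trans_zero_mem (hc2 : c * c = 1) (hn : 2 ≤ n) (hB : 3 ≤ Fintype.card B) (Q : Finset B)
    (hQ1 : 2 * Q.card + 1 ≤ Fintype.card B) (hQ2 : Fintype.card B ≤ 2 * Q.card + 2) {b₁ b₂ : B} (hb₁ : b₁ ∉ Q) (hb₂ : b₂ ∉ Q) (h12 : b₁ ≠ b₂)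
    {k : ℕ} (hk1 : 1 ≤ k) (hk : k < n) (L : Submodule ℤ (CMF G c →₀ ℤ))
    (hstar : ∀ (a : ZMod (2 * n)) (Φ : CMF G c), Φ ∈ nearCl θ hθ hθc a →
      Finsupp.single Φ 1 - thetaG c hc2 (cst θ hθ hθc a) (typeSum G c (Finsupp.single Φ 1)) ∈ L)
    (hface : gface c hc2 (prof θ hθ hθc Q) (θ.symm ((k : ℕ), b₁)) (θ.symm (0, b₂)) ∈ L) :
    trans θ hθ hθc hc2 0 ((k : ℕ) : ZMod (2 * n)) b₁ ∈ L := by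
  have hb₁' : b₁ ∉ insert b₂ Q := by rw [mem_insert]; push Not; exact ⟨h12, hb₁⟩
  have hcard : (insert b₂ Q).card = Q.card + 1 := card_insert_of_notMem hb₂
  -- the four corners and their near classes
  have hq := oflipCM_prof θ hθ hθc hc2 Q hb₂
  have n0 := prof_mem_nearCl_zero θ hθ hθc hc2 hn Q (by omega)
  have n0' := oflipCM_prof_mem_nearCl_zero θ hθ hθc hc2 hn hB Q (by omega) hb₁ hk1 hk
  have n1 := prof_mem_nearCl_one θ hθ hθc hc2 hn (insert b₂ Q) (by omega) (by omega)
  have n1' := oflipCM_prof_mem_nearCl_one θ hθ hθc hc2 hn hB (insert b₂ Q) (by omega) hb₁' hk1 hk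
  -- the two star differences
  have hp0 := symm_natCast_mem_cst_zero θ hθ hθc hk b₁
  have hp1 := symm_natCast_mem_cst_one θ hθ hθc hk1 hk.le b₁
  have hd0 := thetaG_oflipCM_sub_of_mem hc2 hp0 (symm_natCast_mem_prof θ hθ hθc hk Q hb₁)
  have hd1 := thetaG_oflipCM_sub_of_mem hc2 hp1 (symm_natCast_mem_prof θ hθ hθc hk (insert b₂ Q) hb₁')
  rw [sub_eq_iff_eq_add] at hd0 hd1
  have m1 := hstar 0 _ n0
  have m2 := hstar 1 _ n1'
  have m3 := hstar 0 _ n0'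
  have m4 := hstar 1 _ n1
  rw [hd0] at m3
  rw [hd1] at m2
  rw [gface, hq] at hface
  have e : trans θ hθ hθc hc2 0 ((k : ℕ) : ZMod (2 * n)) b₁ =
      (Finsupp.single (prof θ hθ hθc Q) 1 - thetaG c hc2 (cst θ hθ hθc 0) (typeSum G c (Finsupp.single (prof θ hθ hθc Q) 1)))
      + (Finsupp.single (oflipCM c hc2 (θ.symm ((k : ℕ), b₁)) (prof θ hθ hθc (insert b₂ Q))) 1
          - (Finsupp.single (oflipCM c hc2 (θ.symm ((k : ℕ), b₁)) (cst θ hθ hθc 1)) 1 - Finsupp.single (cst θ hθ hθc 1) 1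
              + thetaG c hc2 (cst θ hθ hθc 1) (typeSum G c (Finsupp.single (prof θ hθ hθc (insert b₂ Q)) 1))))
      - (Finsupp.single (oflipCM c hc2 (θ.symm ((k : ℕ), b₁)) (prof θ hθ hθc Q)) 1
          - (Finsupp.single (oflipCM c hc2 (θ.symm ((k : ℕ), b₁)) (cst θ hθ hθc 0)) 1 - Finsupp.single (cst θ hθ hθc 0) 1
              + thetaG c hc2 (cst θ hθ hθc 0) (typeSum G c (Finsupp.single (prof θ hθ hθc Q) 1))))
      - (Finsupp.single (prof θ hθ hθc (insert b₂ Q)) 1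
          - thetaG c hc2 (cst θ hθ hθc 1) (typeSum G c (Finsupp.single (prof θ hθ hθc (insert b₂ Q)) 1)))
      - (Finsupp.single (prof θ hθ hθc Q) 1
          + Finsupp.single (oflipCM c hc2 (θ.symm ((k : ℕ), b₁)) (prof θ hθ hθc (insert b₂ Q))) 1
          - Finsupp.single (oflipCM c hc2 (θ.symm ((k : ℕ), b₁)) (prof θ hθ hθc Q)) 1
          - Finsupp.single (prof θ hθ hθc (insert b₂ Q)) 1) := by
    rw [trans, zero_add]; abel
  rw [e]
  exact Submodule.sub_mem _ (Submodule.sub_mem _ (Submodule.sub_mem _ (Submodule.add_mem _ m1 m2) m3) m4) hface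

/-! ## §2 The equatorial square -/

omit [Fintype B] in
/-- The star form of `prof Q` about the centre `0`: `Σ_{b ∈ Q} ([catom 0 b] − [cst 0]) + [cst 0]`. [folklore] -/
theorem thetaG_prof_zero (hc2 : c * c = 1) (Q : Finset B) :
    thetaG c hc2 (cst θ hθ hθc 0) (typeSum G c (Finsupp.single (prof θ hθ hθc Q) 1)) =
      (∑ b ∈ Q, (Finsupp.single (catom θ hθ hθc hc2 0 b) 1 - Finsupp.single (cst θ hθ hθc 0) 1)) + Finsupp.single (cst θ hθ hθc 0) 1 := by
  rw [thetaG_typeSum_single, sdiff_cst_zero_prof,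
    sum_image fun b _ b' _ h => by simpa using congrArg (fun P => (θ P).2) h]
  rfl

/-- The star form of `prof Q` about the centre `1`: `Σ_{b ∉ Q} ([cst 1^{(θ⁻¹(n,b))}] − [cst 1]) + [cst 1]`. [folklore] -/
theorem thetaG_prof_one (hc2 : c * c = 1) (Q : Finset B) :
    thetaG c hc2 (cst θ hθ hθc 1) (typeSum G c (Finsupp.single (prof θ hθ hθc Q) 1)) =
      (∑ b ∈ univ.filter (fun b => b ∉ Q),
        (Finsupp.single (oflipCM c hc2 (θ.symm ((n : ℕ), b)) (cst θ hθ hθc 1)) 1 - Finsupp.single (cst θ hθ hθc 1) 1))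
      + Finsupp.single (cst θ hθ hθc 1) 1 := by
  rw [thetaG_typeSum_single, sdiff_cst_one_prof,
    sum_image fun b _ b' _ h => by simpa using congrArg (fun P => (θ P).2) h]

omit [DecidableEq B] [Fintype B] in
/-- **Lower atoms are canonical atoms modulo transfers and pairs**: if `ℤ⟨pairs⟩ ≤ L` and `L` holds the interior transfers, then
`([cst 1^{(θ⁻¹(n,b))}] − [cst 1]) + ([catom 0 b] − [cst 0]) ∈ L`. [folklore] -/
theorem lower_add_catom_sub_mem (hc2 : c * c = 1) (L : Submodule ℤ (CMF G c →₀ ℤ)) (hP : Submodule.span ℤ (pairSet c) ≤ L)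
    (hT : ∀ (a x : ZMod (2 * n)) (b : B), 1 ≤ (x - a).val → (x - a).val < n → trans θ hθ hθc hc2 a x b ∈ L) (b : B) :
    (Finsupp.single (oflipCM c hc2 (θ.symm ((n : ℕ), b)) (cst θ hθ hθc 1)) 1 - Finsupp.single (cst θ hθ hθc 1) 1)
      + (Finsupp.single (catom θ hθ hθc hc2 0 b) 1 - Finsupp.single (cst θ hθ hθc 0) 1) ∈ L := by
  have hn1 : 1 ≤ n := Nat.one_le_iff_ne_zero.mpr (NeZero.ne n)
  have h1 : (1 : ZMod (2 * n)).val = 1 := by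
    rw [show (1 : ZMod (2 * n)) = ((1 : ℕ) : ZMod (2 * n)) by norm_cast, ZMod.val_cast_of_lt (by omega)]
  have hval : (((n : ℕ) : ZMod (2 * n)) - 1).val = n - 1 := by
    rw [ZMod.val_sub (by rw [h1, val_n]; exact hn1), val_n, h1]
  have hchain := single_oflipCM_cst_sub_mem θ hθ hθc hc2 L hT (n - 1) 1 ((n : ℕ) : ZMod (2 * n)) b hval (by omega)
  have hpa := single_catom_add_mem_span_pairSet θ hθ hθc hc2 0 b
  have hpc := single_cst_add_mem_span_pairSet θ hθ hθc (0 : ZMod (2 * n))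
  rw [zero_add] at hpa hpc
  have e : ((Finsupp.single (oflipCM c hc2 (θ.symm ((n : ℕ), b)) (cst θ hθ hθc 1)) (1 : ℤ) - Finsupp.single (cst θ hθ hθc 1) 1)
      + (Finsupp.single (catom θ hθ hθc hc2 0 b) 1 - Finsupp.single (cst θ hθ hθc 0) 1) : CMF G c →₀ ℤ) =
      (Finsupp.single (oflipCM c hc2 (θ.symm ((n : ℕ), b)) (cst θ hθ hθc 1)) 1 - Finsupp.single (cst θ hθ hθc 1) 1
        - (Finsupp.single (catom θ hθ hθc hc2 (n : ℕ) b) 1 - Finsupp.single (cst θ hθ hθc (n : ℕ)) 1))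
      + (Finsupp.single (catom θ hθ hθc hc2 0 b) 1 + Finsupp.single (catom θ hθ hθc hc2 (n : ℕ) b) 1)
      - (Finsupp.single (cst θ hθ hθc 0) 1 + Finsupp.single (cst θ hθ hθc (n : ℕ)) 1) := by abel
  rw [e]
  exact Submodule.sub_mem _ (Submodule.add_mem _ hchain (hP hpa)) (hP hpc)

/-- **THE EQUATORIAL SQUARE REDUCES TO THE UPPER STAR.**  If `ℤ⟨pairs⟩ ≤ L`, `L` holds the star forms of the near classes, the interior
transfers and the face `gface (prof Q) θ⁻¹(0, b₁) θ⁻¹(0, b₂)` (`b₁ ≠ b₂` outside `Q`, `2|Q| + 1 ≤ |B| ≤ 2|Q| + 2`), then `wplus 0 ∈ L`. [folklore] -/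
theorem wplus_zero_mem (hc2 : c * c = 1) (hn : 2 ≤ n) (Q : Finset B)
    (hQ1 : 2 * Q.card + 1 ≤ Fintype.card B) (hQ2 : Fintype.card B ≤ 2 * Q.card + 2) {b₁ b₂ : B} (hb₁ : b₁ ∉ Q) (hb₂ : b₂ ∉ Q) (h12 : b₁ ≠ b₂)
    (L : Submodule ℤ (CMF G c →₀ ℤ)) (hP : Submodule.span ℤ (pairSet c) ≤ L)
    (hstar : ∀ (a : ZMod (2 * n)) (Φ : CMF G c), Φ ∈ nearCl θ hθ hθc a →
      Finsupp.single Φ 1 - thetaG c hc2 (cst θ hθ hθc a) (typeSum G c (Finsupp.single Φ 1)) ∈ L)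
    (hT : ∀ (a x : ZMod (2 * n)) (b : B), 1 ≤ (x - a).val → (x - a).val < n → trans θ hθ hθc hc2 a x b ∈ L)
    (hface : gface c hc2 (prof θ hθ hθc Q) (θ.symm (0, b₁)) (θ.symm (0, b₂)) ∈ L) :
    wplus θ hθ hθc hc2 0 ∈ L := by
  classical
  have hb₁' : b₁ ∉ insert b₂ Q := by rw [mem_insert]; push Not; exact ⟨h12, hb₁⟩
  have hb₂' : b₂ ∉ insert b₁ Q := by rw [mem_insert]; push Not; exact ⟨h12.symm, hb₂⟩
  have hc1 : (insert b₁ Q).card = Q.card + 1 := card_insert_of_notMem hb₁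
  have hc2' : (insert b₂ Q).card = Q.card + 1 := card_insert_of_notMem hb₂
  have hc12 : (insert b₁ (insert b₂ Q)).card = Q.card + 2 := by rw [card_insert_of_notMem hb₁', hc2']
  -- the four corners
  have hp := oflipCM_prof θ hθ hθc hc2 Q hb₁
  have hq := oflipCM_prof θ hθ hθc hc2 Q hb₂
  have hpq := oflipCM_prof θ hθ hθc hc2 (insert b₂ Q) hb₁'
  rw [gface, hq, hpq, hp] at hface
  have m1 := hstar 0 _ (prof_mem_nearCl_zero θ hθ hθc hc2 hn Q (by omega))
  have m2 := hstar 1 _ (prof_mem_nearCl_one θ hθ hθc hc2 hn (insert b₁ (insert b₂ Q)) (by omega) (by omega))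
  have m3 := hstar 1 _ (prof_mem_nearCl_one θ hθ hθc hc2 hn (insert b₁ Q) (by omega) (by omega))
  have m4 := hstar 1 _ (prof_mem_nearCl_one θ hθ hθc hc2 hn (insert b₂ Q) (by omega) (by omega))
  rw [thetaG_prof_zero] at m1
  rw [thetaG_prof_one] at m2 m3 m4
  -- the complements: `{b ∉ Q₁} = insert b₂ R`, `{b ∉ Q₂} = insert b₁ R`, `{b ∉ Q} = insert b₁ (insert b₂ R)`, `R = {b ∉ Q₁₂}`
  set R : Finset B := univ.filter fun b => b ∉ insert b₁ (insert b₂ Q) with hR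
  have hRb₁ : b₁ ∉ R := by rw [hR, mem_filter]; simp
  have hRb₂ : b₂ ∉ R := by rw [hR, mem_filter]; simp
  have hRb₂' : b₂ ∉ insert b₁ R := by rw [mem_insert]; push Not; exact ⟨h12.symm, hRb₂⟩
  have e1 : univ.filter (fun b => b ∉ insert b₁ Q) = insert b₂ R := by
    ext b; simp only [hR, mem_filter, mem_univ, true_and, mem_insert, not_or]
    by_cases hb : b = b₂
    · subst hb; simp [h12.symm, hb₂]
    · simp [hb]
  have e2 : univ.filter (fun b => b ∉ insert b₂ Q) = insert b₁ R := by
    ext b; simp only [hR, mem_filter, mem_univ, true_and, mem_insert, not_or]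
    by_cases hb : b = b₁
    · subst hb; simp [h12, hb₁]
    · simp [hb]
  have e0 : univ.filter (fun b => b ∉ Q) = insert b₁ (insert b₂ R) := by
    ext b; simp only [hR, mem_filter, mem_univ, true_and, mem_insert, not_or]
    by_cases hb : b = b₁
    · subst hb; simp [hb₁]
    · by_cases hb' : b = b₂
      · subst hb'; simp [hb₂]
      · simp [hb, hb']
  rw [e1, sum_insert hRb₂] at m3
  rw [e2, sum_insert hRb₁] at m4
  -- the X-relations of the columns outside `Q`, summed
  have hX : ∑ b ∈ insert b₁ (insert b₂ R),
      ((Finsupp.single (oflipCM c hc2 (θ.symm ((n : ℕ), b)) (cst θ hθ hθc 1)) 1 - Finsupp.single (cst θ hθ hθc 1) 1)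
        + (Finsupp.single (catom θ hθ hθc hc2 0 b) 1 - Finsupp.single (cst θ hθ hθc 0) 1)) ∈ L :=
    Submodule.sum_mem _ fun b _ => lower_add_catom_sub_mem θ hθ hθc hc2 L hP hT b
  rw [sum_insert (by rw [mem_insert]; push Not; exact ⟨h12, hRb₁⟩), sum_insert hRb₂, sum_add_distrib] at hX
  -- the sum of all canonical atoms splits over `Q` and its complement
  have hsplit : ∑ b : B, Finsupp.single (catom θ hθ hθc hc2 0 b) (1 : ℤ) =
      (∑ b ∈ Q, Finsupp.single (catom θ hθ hθc hc2 0 b) 1) + ∑ b ∈ insert b₁ (insert b₂ R), Finsupp.single (catom θ hθ hθc hc2 0 b) 1 := by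
    rw [← e0, ← sum_filter_add_sum_filter_not univ (fun b => b ∈ Q)]
    congr 1
    congr 1; ext b; simp
  have hcardR : (Fintype.card B : ℤ) = Q.card + (R.card + 2) := by
    have h := Finset.card_filter_add_card_filter_not (s := (univ : Finset B)) (fun b => b ∈ Q)
    have e : univ.filter (fun b => b ∈ Q) = Q := by ext b; simp
    rw [e, e0, card_insert_of_notMem (by rw [mem_insert]; push Not; exact ⟨h12, hRb₁⟩), card_insert_of_notMem hRb₂, card_univ] at h
    push_cast [← h]; ring
  -- scalar bookkeeping at the centre `cst 0`
  have hsm : ((Fintype.card B : ℤ) - 1) • (Finsupp.single (cst θ hθ hθc 0) (1 : ℤ)) =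
      (Q.card : ℤ) • Finsupp.single (cst θ hθ hθc 0) 1 + (R.card : ℤ) • Finsupp.single (cst θ hθ hθc 0) 1
        + Finsupp.single (cst θ hθ hθc 0) 1 := by
    rw [hcardR, show ((Q.card : ℤ) + (R.card + 2) - 1) = (Q.card : ℤ) + R.card + 1 by ring, add_smul, add_smul, one_smul]
  have hQsum : ∑ b ∈ Q, (Finsupp.single (catom θ hθ hθc hc2 0 b) (1 : ℤ) - Finsupp.single (cst θ hθ hθc 0) 1) =
      (∑ b ∈ Q, Finsupp.single (catom θ hθ hθc hc2 0 b) 1) - (Q.card : ℤ) • Finsupp.single (cst θ hθ hθc 0) 1 := by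
    rw [sum_sub_distrib, sum_const, ← natCast_zsmul]
  have hRsum : ∑ b ∈ R, (Finsupp.single (catom θ hθ hθc hc2 0 b) (1 : ℤ) - Finsupp.single (cst θ hθ hθc 0) 1) =
      (∑ b ∈ R, Finsupp.single (catom θ hθ hθc hc2 0 b) 1) - (R.card : ℤ) • Finsupp.single (cst θ hθ hθc 0) 1 := by
    rw [sum_sub_distrib, sum_const, ← natCast_zsmul]
  rw [hQsum] at m1
  rw [hRsum] at hX
  rw [sum_insert (by rw [mem_insert]; push Not; exact ⟨h12, hRb₁⟩), sum_insert hRb₂] at hsplit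
  -- assemble: `wplus 0 = (face + Σ X) − (T₁ + T₂ − T₃ − T₄)`
  have key := Submodule.sub_mem _ (Submodule.add_mem _ hface hX)
    (Submodule.sub_mem _ (Submodule.sub_mem _ (Submodule.add_mem _ m1 m2) m3) m4)
  convert key using 1
  rw [wplus, zero_add, hsm, hsplit]
  abel

end

end Summit.HodgeConjecture.CorCM.Census.TwistGeneration
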